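import Summits.Ventures.Crystal3D.Theorems.StickyWulffConstantTextureLiminfTexShadowLevelReachPlatesFluxAreaCell
import Summits.Ventures.Crystal3D.Theorems.StickyWulffConstantTextureLiminfTexShadowAreaCensusGlue
import Summits.Ventures.Crystal3D.Theorems.StickyWulffConstantCoaxialWallLawEndRowJointDefs
import Summits.Ventures.Crystal3D.Theorems.StickyWulffConstantCoaxialWallLawOnSiteTools
import HarnessLib

/-!
# (β) PLATES-ONLY CELL LAW: the two clamped plates' hexagon lines alone pay a capped table, modulo the row BY NAME and located cuts
# (lane T, crux `TextureLiminfV5`, stmt-Ventures-23912, registered stub `stub_terraceCensus`; BETA-CUT-g22 §3(i)/§4(d), BETA-PLATES-g23 §3; cf-p1 (cccxvii))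

HONEST FRAMING. Venture `Summits/Ventures/Crystal3D` (cell `crystal3d-full`), route `route-Ventures-StickyWulffConstant`, helper `--supports` the
law-v5 crux `TextureLiminfV5` (stmt-Ventures-23912), lane T, mechanism (β).  CONDITIONAL on three named/explicit hypotheses and census-free otherwise;
standard axioms; `KissingGap δ` / `KissingClassification δ` BY NAME; nothing is claimed about `stub_terraceCensus` itself; F-C1 not moved.

THE STATEMENT (`platesOnly_bilayerWallAt`).  Two Hägg plates `(L₁, s₁, σ₁)`, `(L₂, s₂, σ₂)` with root frames `Fr ∈ {L₁, bM ≫ L₁}` (type `t`) and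
`G₂ ∈ {L₂, bM ≫ L₂}` (type `t'`), the four dozen inequalities of the pooled census, words all of whose layers are admissible for the chosen types
(`¬(σ(k−1) = −t ∧ σ k = −t)` for every `k`; hcp-like words, or the fcc word of its own type), a table `0 ≤ c ≤ c₀`, and
(ROW)  `LocalEndRowA ver sF ⟨Fr, inPlaneRoots Fr 1⟩ ⟨G₂, inPlaneRoots G₂ (−1)⟩` BY NAME (`sF > 0`; the (α) certificate of record feeds it through
       `localEndRowA_basal_of_biFrameWin₃` + antitonicity, 19481 lineage),
(CUT)  in every cell of radius `ρ ≥ R₀ + 2` the located coherent cuts met by the two hexagon families are `≤ C_cut·(1+h)·ρ`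
       (the hypothesis of BETA-CUT §3(i): «the hexagon lines meet no coherent cut plane inside the filling», up to rims),
(SUP)  the SUPPLY INEQUALITY in tilt currency `2·c₀·sF ≤ √6·(S₁ + S₂)`, `S_i = √(1 − ν_{i,2}²)` the sine of plate `i`'s basal tilt
       (at `c₀ = 13/25`, `sF = 9/2`: `S₁ + S₂ ≥ 1.911`, both tilts `≳ 72.9°` — the sliver of BETA-CUT §3),
THEN `BilayerWallAt C R₀ σ₁ σ₂ L₁ L₂ s₁ s₂ c` with the explicit uniform constant
`C = ((C_cut + 3456·sF + 1710840)/sF + 16·√6·π/sF + 2·c₀·π·(R₀+2) + 3456 + 1152·(R₀+1))/2`.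
PROOF = `hexagon_twoPlate_area_le_payerSum` (…PlatesFluxAreaCell: pooled census p748129 + flux-to-area) + `tilt_area_le_root_area` +
`bilayerWallAt_of_areaCensus` (…AreaCensusGlue: charge `≤ c₀πρ²`, payer bound, `bilayerWallAt_of_payerBound`).
ROW CURRENCIES.  `localEndRowA_inPlane_of_basal` — the (A) row for the BASAL systems `(basalSystem Fr, basalSystem G₂)` (the lane-T registrable
text «`∀ Fr G₂, LocalEndRowA v2 (9/2) (basalSystem Fr) (basalSystem G₂)`», cf-p1 (cccxvi)(3)) gives the row for the in-plane systems (antitonicity in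
the admissible classes; a poison-free twin of `localEndRowA_of_systems` of …RowsOfJoint, whose import closure declares `TexShadow.stub_l12Local`);
`platesOnly_bilayerWallAt_basal` — the cell law under the basal row.  This module's import closure is lane-T-clean (farm probe).
WHAT THIS IS NOT: a proof of `stub_terraceCensus` (the census regime / edge-on class is not related to (SUP) here; (CUT) is a hypothesis, not a
theorem; born lines are not counted); no certificate is used or claimed; F-C1 not moved.
-/

noncomputable section

namespace Summit.Ventures.Crystal3D.Theorems

open Summit.Ventures.Crystal3D Finset MeasureTheory
open Literature.MathematicalPhysics.StatisticalMechanics (IsHaggSeq basalMirror)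
open Summit.Ventures.Crystal3D.Cruxes.TextureLiminf.TexShadow (E3 cyl stacking laySlab BilayerWallAt bilayerWallAt_mono)
open scoped InnerProductSpace

open scoped Classical in
/-- **THE (β) PLATES-ONLY CELL LAW** (conditional on (ROW), (CUT), (SUP); see the module docstring). -/
theorem platesOnly_bilayerWallAt (ver : WordVersion) {δ : ℝ} (hg : KissingGap δ) (hc : KissingClassification δ)
    {σ₁ σ₂ : ℤ → ℤ} (hσ₁ : IsHaggSeq σ₁) (hσ₂ : IsHaggSeq σ₂) (L₁ L₂ : E3 ≃ₗᵢ[ℝ] E3) (s₁ s₂ : E3)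
    (Fr : E3 ≃ₗᵢ[ℝ] E3) {t : ℤ} (hFr : (t = 1 ∧ Fr = L₁) ∨ (t = -1 ∧ Fr = basalMirror.trans L₁))
    (G₂ : E3 ≃ₗᵢ[ℝ] E3) {t' : ℤ} (hG₂ : (t' = 1 ∧ G₂ = L₂) ∨ (t' = -1 ∧ G₂ = basalMirror.trans L₂))
    (hne₁ : (Fr : E3 → E3) '' ↑fccSlots ≠ (L₂ : E3 → E3) '' ↑fccSlots)
    (hne₂ : (Fr : E3 → E3) '' ↑fccSlots ≠ ((basalMirror.trans L₂ : E3 ≃ₗᵢ[ℝ] E3) : E3 → E3) '' ↑fccSlots)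
    (hne₁' : (G₂ : E3 → E3) '' ↑fccSlots ≠ (L₁ : E3 → E3) '' ↑fccSlots)
    (hne₂' : (G₂ : E3 → E3) '' ↑fccSlots ≠ ((basalMirror.trans L₁ : E3 ≃ₗᵢ[ℝ] E3) : E3 → E3) '' ↑fccSlots)
    {sF : ℝ} (hsF : 0 < sF) (hrow : LocalEndRowA ver sF ⟨Fr, inPlaneRoots Fr 1⟩ ⟨G₂, inPlaneRoots G₂ (-1)⟩)
    (hadm₁ : ∀ k : ℤ, ¬ (σ₁ (k - 1) = -t ∧ σ₁ k = -t)) (hadm₂ : ∀ k : ℤ, ¬ (σ₂ (k - 1) = -t' ∧ σ₂ k = -t'))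
    (R₀ : ℝ) (hR₀ : 5 ≤ R₀) (c : ℤ → ℤ → ℝ) {c₀ : ℝ} (hc0 : ∀ i j, 0 ≤ c i j) (hcB : ∀ i j, c i j ≤ c₀)
    (hsup : 2 * c₀ * sF ≤ Real.sqrt 6 *
      (Real.sqrt (1 - (L₁.symm (EuclideanSpace.single (2 : Fin 3) (1 : ℝ))) 2 ^ 2) +
        Real.sqrt (1 - (L₂.symm (EuclideanSpace.single (2 : Fin 3) (1 : ℝ))) 2 ^ 2)))
    {Ccut : ℝ} (hCcut : 0 ≤ Ccut)
    (hcut : ∀ h : ℝ, 0 ≤ h → ∀ ρ : ℝ, R₀ + 2 ≤ ρ → ∀ X P₁ P₂ : Finset E3,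
      (∀ p ∈ X, ∀ q ∈ X, p ≠ q → 1 ≤ dist p q) → P₁ ⊆ X → P₂ ⊆ X \ P₁ → (∀ p ∈ X, p ∈ cyl R₀ h ρ) →
      (∀ p, p ∈ P₁ ↔ (p ∈ stacking L₁ s₁ σ₁ ∧ -(2 * R₀) ≤ p 2 ∧ p 2 ≤ -R₀ ∧ p 0 ^ 2 + p 1 ^ 2 ≤ ρ ^ 2)) →
      (∀ p, p ∈ P₂ ↔ (p ∈ stacking L₂ s₂ σ₂ ∧ h + R₀ ≤ p 2 ∧ p 2 ≤ h + 2 * R₀ ∧ p 0 ^ 2 + p 1 ^ 2 ≤ ρ ^ 2)) →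
      ((∑ r ∈ inPlaneRoots Fr 1, (X.filter fun b => -(R₀ + 1) - 1 ≤ b 2 ∧ b 2 < h + (R₀ + 1) + 1 ∧
            (∃ μ, ⟪r, μ⟫_ℝ = Real.sqrt (2 / 3) ∧ IsTwinReading X Fr (Fr μ) b) ∧ b - Fr r ∈ X).card : ℕ) : ℝ) +
        ((∑ r ∈ inPlaneRoots G₂ (-1), (X.filter fun b => -(R₀ + 1) - 1 < b 2 ∧ b 2 ≤ h + (R₀ + 1) + 1 ∧
            (∃ μ, ⟪r, μ⟫_ℝ = Real.sqrt (2 / 3) ∧ IsTwinReading X G₂ (G₂ μ) b) ∧ b - G₂ r ∈ X).card : ℕ) : ℝ) ≤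
        Ccut * (1 + h) * ρ) :
    BilayerWallAt (((Ccut + 3456 * sF + 1710840) / sF + 16 * Real.sqrt 6 * Real.pi / sF + 2 * c₀ * Real.pi * (R₀ + 2) +
        3456 + 1152 * (R₀ + 1)) / 2) R₀ σ₁ σ₂ L₁ L₂ s₁ s₂ c := by
  set S₁ : ℝ := Real.sqrt (1 - (L₁.symm (EuclideanSpace.single (2 : Fin 3) (1 : ℝ))) 2 ^ 2) with hS₁
  set S₂ : ℝ := Real.sqrt (1 - (L₂.symm (EuclideanSpace.single (2 : Fin 3) (1 : ℝ))) 2 ^ 2) with hS₂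
  have hS₁1 : S₁ ≤ 1 := by
    rw [hS₁]
    calc Real.sqrt (1 - (L₁.symm (EuclideanSpace.single (2 : Fin 3) (1 : ℝ))) 2 ^ 2) ≤ Real.sqrt 1 :=
          Real.sqrt_le_sqrt (by nlinarith [sq_nonneg ((L₁.symm (EuclideanSpace.single (2 : Fin 3) (1 : ℝ))) 2)])
      _ = 1 := Real.sqrt_one
  have hS₂1 : S₂ ≤ 1 := by
    rw [hS₂]
    calc Real.sqrt (1 - (L₂.symm (EuclideanSpace.single (2 : Fin 3) (1 : ℝ))) 2 ^ 2) ≤ Real.sqrt 1 :=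
          Real.sqrt_le_sqrt (by nlinarith [sq_nonneg ((L₂.symm (EuclideanSpace.single (2 : Fin 3) (1 : ℝ))) 2)])
      _ = 1 := Real.sqrt_one
  have hS₁0 : 0 ≤ S₁ := Real.sqrt_nonneg _
  have hS₂0 : 0 ≤ S₂ := Real.sqrt_nonneg _
  have hR₀3 : 3 ≤ R₀ := by linarith
  have hR₀0 : 0 ≤ R₀ := by linarith
  have hc₀ : 0 ≤ c₀ := (hc0 0 0).trans (hcB 0 0)
  set M : ℝ := Real.sqrt 6 * (S₁ + S₂) with hM
  have hM2 : M ≤ 2 * Real.sqrt 6 := by rw [hM]; nlinarith [Real.sqrt_nonneg 6]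
  -- the census in area currency, cell by cell, for `ρ ≥ R₀ + 2`
  have hW := bilayerWallAt_of_areaCensus hσ₁ hσ₂ L₁ L₂ s₁ s₂ R₀ hR₀3 c hc0 hcB (sF := sF) (M := M)
    (Crest := Ccut + 3456 * sF + 1710840) (ρ₀ := R₀ + 2) hsF (by rw [hM]; exact hsup) (by positivity) (by linarith) ?_
  · -- weaken the rim constant to the uniform one (`M ≤ 2√6`)
    refine bilayerWallAt_mono hR₀0 ?_ hW
    have h1 : 8 * M * Real.pi / sF ≤ 16 * Real.sqrt 6 * Real.pi / sF := by
      refine div_le_div_of_nonneg_right ?_ hsF.le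
      nlinarith [Real.pi_pos.le, mul_le_mul_of_nonneg_right hM2 Real.pi_pos.le]
    linarith
  -- the census hypothesis
  intro h hh ρ hρ X P₁ P₂ hX hP₁X hP₂X' hcyl hP₁ hP₂
  have hP₂X : P₂ ⊆ X := fun p hp => (Finset.mem_sdiff.1 (hP₂X' hp)).1
  have hcell : ∀ p ∈ X, -(2 * R₀) ≤ p 2 ∧ p 2 ≤ h + 2 * R₀ ∧ p 0 ^ 2 + p 1 ^ 2 ≤ ρ ^ 2 := fun p hp => hcyl p hp
  have harea := hexagon_twoPlate_area_le_payerSum ver hg hc hσ₁ hσ₂ L₁ L₂ s₁ s₂ Fr hFr G₂ hG₂ hne₁ hne₂ hne₁' hne₂' hsF.le hrow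
    hadm₁ hadm₂ X P₁ P₂ R₀ h ρ hR₀ hh hρ hX hP₁X hP₂X hcell hP₁ hP₂
  have htilt := tilt_area_le_root_area (sum_inPlaneRoots_rise_ge_sqrt3 hFr) (sum_inPlaneRoots_fall_ge_sqrt3 hG₂) ρ
  have hcuts := hcut h hh ρ hρ X P₁ P₂ hX hP₁X hP₂X' hcyl hP₁ hP₂
  have hρ0 : 0 ≤ ρ := by linarith
  have hrim : (3456 * sF + 1710840) * ρ ≤ (3456 * sF + 1710840) * (1 + h) * ρ := by
    have : 0 ≤ (3456 * sF + 1710840) * ρ := by positivity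
    nlinarith
  have e : M * Real.pi * (ρ - 4) ^ 2 = Real.sqrt 6 * Real.pi * (S₁ + S₂) * (ρ - 4) ^ 2 := by rw [hM]; ring
  rw [e]
  linarith [harea, htilt, hcuts, hrim]

/-! ## The row in the lane-T registrable currency -/

open scoped Classical in
/-- **Antitonicity, poison-free**: the (A) local row for the BASAL systems of two frames gives the row for the in-plane systems (bottom: rising roots,
top: falling roots) — admissible classes of `⟨G₀, R⟩` are admissible for `⟨G₀, R'⟩` when `R ⊆ R'`, multiplicities grow, pools do not change. -/
theorem localEndRowA_inPlane_of_basal {v : WordVersion} {sF : ℝ} (Fr G₂ : E3 ≃ₗᵢ[ℝ] E3)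
    (h : LocalEndRowA v sF (basalSystem Fr) (basalSystem G₂)) :
    LocalEndRowA v sF ⟨Fr, inPlaneRoots Fr 1⟩ ⟨G₂, inPlaneRoots G₂ (-1)⟩ := by
  intro X hX z hz hdeg
  -- admissible classes transfer up an inclusion of root sets (same frame)
  have mono : ∀ (G₀ : E3 ≃ₗᵢ[ℝ] E3) (R R' : Finset E3), R ⊆ R' → ∀ (G : E3 ≃ₗᵢ[ℝ] E3) (d : E3),
      (⟨G₀, R⟩ : PlateSystem).Adm G d → (⟨G₀, R'⟩ : PlateSystem).Adm G d := by
    intro G₀ R R' hRR' G d hadm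
    obtain ⟨r, hr, κ, hκ, hG, hd⟩ := hadm
    have e : (⟨G₀, R⟩ : PlateSystem).Fw κ = (⟨G₀, R'⟩ : PlateSystem).Fw κ :=
      PlateSystem.fw_eq_of_G₀ (S := ⟨G₀, R⟩) (S' := ⟨G₀, R'⟩) rfl κ
    exact ⟨r, hRR' hr, κ, hκ, by rw [hG, e], by rw [hd, e]⟩
  have hS : ∀ (G : E3 ≃ₗᵢ[ℝ] E3) (d : E3),
      ((⟨Fr, inPlaneRoots Fr 1⟩ : PlateSystem).Adm G d ∨ (⟨G₂, inPlaneRoots G₂ (-1)⟩ : PlateSystem).Adm G d) →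
      ((basalSystem Fr).Adm G d ∨ (basalSystem G₂).Adm G d) := by
    rintro G d (hG | hG)
    · exact Or.inl (mono _ _ _ (inPlaneRoots_subset_basalHexagon Fr 1) G d hG)
    · exact Or.inr (mono _ _ _ (inPlaneRoots_subset_basalHexagon G₂ (-1)) G d hG)
  -- multiplicities grow, pools are nonnegative
  have hmult : ∀ b, endMultA X v ⟨Fr, inPlaneRoots Fr 1⟩ ⟨G₂, inPlaneRoots G₂ (-1)⟩ b ≤ endMultA X v (basalSystem Fr) (basalSystem G₂) b := by
    intro b
    unfold endMultA
    refine card_le_card fun q hq => mem_filter.2 ⟨(mem_filter.1 hq).1, ?_⟩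
    obtain ⟨hq', hb, hpay, G, d, hadm, hpred, hmove⟩ := (mem_filter.1 hq).2
    exact ⟨hq', hb, hpay, G, d, hS G d hadm, hpred, hmove⟩
  have hp : ∀ b, 0 ≤ pooledDef X b := fun b => by
    unfold pooledDef
    refine sum_nonneg fun y hy => ?_
    have h11 : ((X.filter fun q => dist y q = 1).card : ℝ) ≤ 11 := by exact_mod_cast (mem_filter.1 hy).2.2
    linarith
  calc ∑ b ∈ X.filter (fun b => dist z b ≤ 1 ∧ 0 < endMultA X v ⟨Fr, inPlaneRoots Fr 1⟩ ⟨G₂, inPlaneRoots G₂ (-1)⟩ b),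
        (endMultA X v ⟨Fr, inPlaneRoots Fr 1⟩ ⟨G₂, inPlaneRoots G₂ (-1)⟩ b : ℝ) / pooledDef X b
      ≤ ∑ b ∈ X.filter (fun b => dist z b ≤ 1 ∧ 0 < endMultA X v ⟨Fr, inPlaneRoots Fr 1⟩ ⟨G₂, inPlaneRoots G₂ (-1)⟩ b),
          (endMultA X v (basalSystem Fr) (basalSystem G₂) b : ℝ) / pooledDef X b :=
        sum_le_sum fun b _ => div_le_div_of_nonneg_right (by exact_mod_cast hmult b) (hp b)
    _ ≤ ∑ b ∈ X.filter (fun b => dist z b ≤ 1 ∧ 0 < endMultA X v (basalSystem Fr) (basalSystem G₂) b),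
          (endMultA X v (basalSystem Fr) (basalSystem G₂) b : ℝ) / pooledDef X b := by
        refine sum_le_sum_of_subset_of_nonneg (fun b hb => ?_) fun b _ _ => div_nonneg (Nat.cast_nonneg _) (hp b)
        obtain ⟨hbX, hd, hpos⟩ := mem_filter.1 hb
        exact mem_filter.2 ⟨hbX, hd, lt_of_lt_of_le hpos (hmult b)⟩
    _ ≤ sF := h X hX z hz hdeg

open scoped Classical in
/-- **THE (β) PLATES-ONLY CELL LAW under the BASAL row** `LocalEndRowA ver sF (basalSystem Fr) (basalSystem G₂)` (the lane-T registrable currency). -/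
theorem platesOnly_bilayerWallAt_basal (ver : WordVersion) {δ : ℝ} (hg : KissingGap δ) (hc : KissingClassification δ)
    {σ₁ σ₂ : ℤ → ℤ} (hσ₁ : IsHaggSeq σ₁) (hσ₂ : IsHaggSeq σ₂) (L₁ L₂ : E3 ≃ₗᵢ[ℝ] E3) (s₁ s₂ : E3)
    (Fr : E3 ≃ₗᵢ[ℝ] E3) {t : ℤ} (hFr : (t = 1 ∧ Fr = L₁) ∨ (t = -1 ∧ Fr = basalMirror.trans L₁))
    (G₂ : E3 ≃ₗᵢ[ℝ] E3) {t' : ℤ} (hG₂ : (t' = 1 ∧ G₂ = L₂) ∨ (t' = -1 ∧ G₂ = basalMirror.trans L₂))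
    (hne₁ : (Fr : E3 → E3) '' ↑fccSlots ≠ (L₂ : E3 → E3) '' ↑fccSlots)
    (hne₂ : (Fr : E3 → E3) '' ↑fccSlots ≠ ((basalMirror.trans L₂ : E3 ≃ₗᵢ[ℝ] E3) : E3 → E3) '' ↑fccSlots)
    (hne₁' : (G₂ : E3 → E3) '' ↑fccSlots ≠ (L₁ : E3 → E3) '' ↑fccSlots)
    (hne₂' : (G₂ : E3 → E3) '' ↑fccSlots ≠ ((basalMirror.trans L₁ : E3 ≃ₗᵢ[ℝ] E3) : E3 → E3) '' ↑fccSlots)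
    {sF : ℝ} (hsF : 0 < sF) (hrow : LocalEndRowA ver sF (basalSystem Fr) (basalSystem G₂))
    (hadm₁ : ∀ k : ℤ, ¬ (σ₁ (k - 1) = -t ∧ σ₁ k = -t)) (hadm₂ : ∀ k : ℤ, ¬ (σ₂ (k - 1) = -t' ∧ σ₂ k = -t'))
    (R₀ : ℝ) (hR₀ : 5 ≤ R₀) (c : ℤ → ℤ → ℝ) {c₀ : ℝ} (hc0 : ∀ i j, 0 ≤ c i j) (hcB : ∀ i j, c i j ≤ c₀)
    (hsup : 2 * c₀ * sF ≤ Real.sqrt 6 *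
      (Real.sqrt (1 - (L₁.symm (EuclideanSpace.single (2 : Fin 3) (1 : ℝ))) 2 ^ 2) +
        Real.sqrt (1 - (L₂.symm (EuclideanSpace.single (2 : Fin 3) (1 : ℝ))) 2 ^ 2)))
    {Ccut : ℝ} (hCcut : 0 ≤ Ccut)
    (hcut : ∀ h : ℝ, 0 ≤ h → ∀ ρ : ℝ, R₀ + 2 ≤ ρ → ∀ X P₁ P₂ : Finset E3,
      (∀ p ∈ X, ∀ q ∈ X, p ≠ q → 1 ≤ dist p q) → P₁ ⊆ X → P₂ ⊆ X \ P₁ → (∀ p ∈ X, p ∈ cyl R₀ h ρ) →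
      (∀ p, p ∈ P₁ ↔ (p ∈ stacking L₁ s₁ σ₁ ∧ -(2 * R₀) ≤ p 2 ∧ p 2 ≤ -R₀ ∧ p 0 ^ 2 + p 1 ^ 2 ≤ ρ ^ 2)) →
      (∀ p, p ∈ P₂ ↔ (p ∈ stacking L₂ s₂ σ₂ ∧ h + R₀ ≤ p 2 ∧ p 2 ≤ h + 2 * R₀ ∧ p 0 ^ 2 + p 1 ^ 2 ≤ ρ ^ 2)) →
      ((∑ r ∈ inPlaneRoots Fr 1, (X.filter fun b => -(R₀ + 1) - 1 ≤ b 2 ∧ b 2 < h + (R₀ + 1) + 1 ∧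
            (∃ μ, ⟪r, μ⟫_ℝ = Real.sqrt (2 / 3) ∧ IsTwinReading X Fr (Fr μ) b) ∧ b - Fr r ∈ X).card : ℕ) : ℝ) +
        ((∑ r ∈ inPlaneRoots G₂ (-1), (X.filter fun b => -(R₀ + 1) - 1 < b 2 ∧ b 2 ≤ h + (R₀ + 1) + 1 ∧
            (∃ μ, ⟪r, μ⟫_ℝ = Real.sqrt (2 / 3) ∧ IsTwinReading X G₂ (G₂ μ) b) ∧ b - G₂ r ∈ X).card : ℕ) : ℝ) ≤
        Ccut * (1 + h) * ρ) :
    BilayerWallAt (((Ccut + 3456 * sF + 1710840) / sF + 16 * Real.sqrt 6 * Real.pi / sF + 2 * c₀ * Real.pi * (R₀ + 2) +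
        3456 + 1152 * (R₀ + 1)) / 2) R₀ σ₁ σ₂ L₁ L₂ s₁ s₂ c :=
  platesOnly_bilayerWallAt ver hg hc hσ₁ hσ₂ L₁ L₂ s₁ s₂ Fr hFr G₂ hG₂ hne₁ hne₂ hne₁' hne₂' hsF
    (localEndRowA_inPlane_of_basal Fr G₂ hrow) hadm₁ hadm₂ R₀ hR₀ c hc0 hcB hsup hCcut hcut

end Summit.Ventures.Crystal3D.Theorems

end
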